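import Summits.HodgeConjecture.CorCM.GaloisRankCertificates
import HarnessLib

/-!
# The rank of a CM type of a Galois CM field, read on a model of its Galois group: right translations, the
# `MulOpposite` action, and the ANNIHILATOR CRITERION for nondegeneracy (any finite group)

COR-CM (cell `pub-hodgecm2`), binder seat b04 (gen 20), count-neutral claim DICYCLIC-TWO-SHEET, part I (sequel of
gen 16's `CorCM/GaloisRankCertificates`, which CERTIFIES lower bounds `r ≤ Rank(Φ)` on a model `e : Gal(K/ℚ) ≃ G₀`;
here the rank is IDENTIFIED with an abstract rank on `G₀`, so that the structural criteria of
`NumberTheory/ComplexMultiplication/CMTypeRank` apply to NON-ABELIAN Galois groups).  KERNEL ONLY: theorems; no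
definition, no named fact, no `sorry`.  `HC_CM` is neither used nor claimed.

SETTING.  `K/ℚ` Galois CM, `e : Gal(K/ℚ) ≃* G₀` a model of its Galois group, `φ₀` a base embedding,
`σ_g = φ₀ ∘ g⁻¹`, `c₀ = e(c)` the image of complex conjugation (central), and the CM type `Φ` read on `G₀` as the
finite set `S = {y | σ_{e⁻¹ y} ∈ Φ}` (`S ⊔ c₀ S = G₀`).  `Aut(ℂ)` acts on the embeddings through RIGHT translations
(`τ ∘ φ₀ = φ₀ ∘ γ` gives `τ σ_g = σ_{g γ⁻¹}`), i.e. through the action of the OPPOSITE group `G₀ᵐᵒᵖ` on `G₀`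
(`op γ • y = y γ`).

* §1 `cmTypeRank_eq_typeRank_op` — `Rank(Φ) = typeRank G₀ᵐᵒᵖ S` (Kubota–Dodson rank of `S` for the right-translation
  action; `typeRank_eq_of_equiv`); `isCMTypeWith_op` — `S` is a CM type for `op c₀` in the abstract sense
  (`IsCMTypeWith`), so that EVERY theorem of `CMTypeRank.lean` (Kubota's bound, Kubota "nondegenerate ⟹ primitive",
  Hazama's balanced-weight criterion, Yanai's prime theorem) applies to `S` — for any finite group `G₀`.
* §2 **`isNondegenerate_iff_forall_annihilator`** — `Φ` is NONDEGENERATE iff every `c₀`-ANTISYMMETRIC weight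
  `b : G₀ → ℚ` (`b(c₀ y) = -b(y)`) ANNIHILATED by all right translates of `S` (`Σ_{s ∈ S} b(s g) = 0` for every `g`)
  vanishes.  (`⟹`: such a `b` is a balanced weight, hence `c₀`-symmetric by Hazama's criterion
  `symm_of_isBalanced_of_typeRank_eq`, hence `0`; `⟸`: for a balanced `ℕ`-weight `F`, `F - F(c₀ ·)` is antisymmetric
  and annihilated, so `F` is symmetric, and `typeRank_eq_of_forall_nat_symm` gives the rank.)  This is the form in
  which the rank is computed by FOURIER ANALYSIS on an abelian subgroup of index `2` in part II
  (`CorCM/TwoSheetAnnihilator`), and on the dicyclic groups in part IV.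
* §3 `isNondegenerate_iff_forall_balanced_symm` — the balanced-weight form itself, on `G₀`.

## References

* [Dodson1987] B. Dodson, J. Algebra 111 (1987), §1.1 p. 50 (`Rank(Φ)` via Galois translates).
* [Kubota1965] T. Kubota, Trans. AMS 118 (1965), §2 p. 115 (rank, nondegenerate ⟹ primitive), §4 Lemma 2.
* [Shimura1998] G. Shimura, *Abelian Varieties with Complex Multiplication and Modular Functions*, §8.1 (`σ_g`),
  §18.2 Lemma (i) (complex conjugation is central and intertwines every embedding).
* [Gordon1999HodgeAVSurvey] B. B. Gordon, *A survey of the Hodge conjecture for abelian varieties*, §9.2–9.4.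
-/

noncomputable section

open NumberField MulOpposite
open scoped BigOperators

namespace Summit.HodgeConjecture.CorCM.GaloisRank

open Literature.NumberTheory.ComplexMultiplication
open Literature.AlgebraicGeometry.Motives (CMType)
open Literature.AlgebraicGeometry.Pohlmann1968
open Summit.HodgeConjecture.CorCM.GaloisOctic (complexConj_mul_comm complexConj_mul_self
  embOf_complexConj_mul_mem_iff)

open scoped Classical

variable {K : Type} [Field K] [NumberField K] [IsCMField K]
variable {G₀ : Type*} [Group G₀] [Fintype G₀] [DecidableEq G₀]

/-! ## §1 The rank as an abstract rank for the right-translation action of `G₀ᵐᵒᵖ` -/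

omit [IsCMField K] [Fintype G₀] [DecidableEq G₀] in
/-- **`Rank(Φ) = typeRank G₀ᵐᵒᵖ S`.**  Along the bijection `y ↦ σ_{e⁻¹ y}` (`G₀ ≃ Hom(K, ℂ)`), a `τ ∈ Aut(ℂ)` with
`τ ∘ φ₀ = φ₀ ∘ γ` acts as `y ↦ y · e(γ)⁻¹ = op (e γ⁻¹) • y`, and every right translation arises this way
(automorphisms of `φ₀(K)` extend to `ℂ`); so the two families of translates coincide and `typeRank_eq_of_equiv`
applies. [cite: Dodson1987, §1.1 (p. 50)] [cite: Shimura1998, §8.1] -/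
theorem cmTypeRank_eq_typeRank_op [Normal ℚ K] (e : (K ≃ₐ[ℚ] K) ≃* G₀) (Φ : CMType K) (φ₀ : K →+* ℂ)
    (S : Finset G₀) (hS : ∀ y : G₀, y ∈ S ↔ embOf φ₀ (e.symm y) ∈ Φ.1) :
    cmTypeRank Φ = typeRank G₀ᵐᵒᵖ (↑S : Set G₀) := by
  let ε : G₀ ≃ (K →+* ℂ) := e.symm.toEquiv.trans (Equiv.ofBijective (embOf φ₀) (embOf_bijective φ₀))
  have hε : ∀ y, ε y = embOf φ₀ (e.symm y) := fun y => rfl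
  have hpre : ε ⁻¹' Φ.1 = (↑S : Set G₀) := by
    ext y
    rw [Set.mem_preimage, hε, Finset.mem_coe, hS]
  rw [cmTypeRank, ← hpre]
  refine typeRank_eq_of_equiv ε Φ.1 (fun τ => ?_) (fun g' => ?_)
  · obtain ⟨γ, hγ⟩ := exists_algEquiv_comp_eq_smul φ₀ τ
    refine ⟨op (e γ⁻¹), fun y => ?_⟩
    rw [Set.mem_preimage, hε, hε, smul_embOf_of_comp φ₀ hγ, op_smul_eq_mul, map_mul, e.symm_apply_apply]
  · obtain ⟨τ, hτ⟩ := exists_ringEquiv_comp_eq_algEquiv φ₀ (e.symm (unop g')⁻¹)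
    refine ⟨τ, fun y => ?_⟩
    rw [Set.mem_preimage, hε, hε, smul_embOf_of_comp φ₀ hτ, map_inv, inv_inv, MulOpposite.smul_eq_mul_unop, map_mul]

omit [Fintype G₀] [DecidableEq G₀] in
/-- `c₀ = e(c)` is central in `G₀` (complex conjugation is central in `Gal(K/ℚ)`). [cite: Shimura1998, §18.2 Lemma (i)] -/
theorem model_complexConj_comm [Normal ℚ K] (e : (K ≃ₐ[ℚ] K) ≃* G₀) {c₀ : G₀}
    (hc : e ((IsCMField.complexConj K).restrictScalars ℚ) = c₀) (y : G₀) : c₀ * y = y * c₀ := by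
  rw [← hc, ← e.apply_symm_apply y, ← map_mul, ← map_mul, complexConj_mul_comm]

omit [Fintype G₀] [DecidableEq G₀] in
/-- `c₀² = 1` in `G₀`. [folklore] -/
theorem model_complexConj_mul_self (e : (K ≃ₐ[ℚ] K) ≃* G₀) {c₀ : G₀}
    (hc : e ((IsCMField.complexConj K).restrictScalars ℚ) = c₀) : c₀ * c₀ = 1 := by
  rw [← hc, ← map_mul, complexConj_mul_self, map_one]

omit [Fintype G₀] [DecidableEq G₀] in
/-- `c₀ ≠ 1` in `G₀`. [folklore] -/
theorem model_complexConj_ne_one (e : (K ≃ₐ[ℚ] K) ≃* G₀) {c₀ : G₀}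
    (hc : e ((IsCMField.complexConj K).restrictScalars ℚ) = c₀) : c₀ ≠ 1 := by
  rw [← hc]
  intro h
  apply IsCMField.complexConj_ne_one K
  have h1 : (IsCMField.complexConj K).restrictScalars ℚ = 1 := e.injective (by rw [h, map_one])
  refine AlgEquiv.ext fun x => ?_
  have := AlgEquiv.congr_fun h1 x
  rw [AlgEquiv.restrictScalars_apply] at this
  rw [this]; rfl

omit [Fintype G₀] [DecidableEq G₀] in
/-- **The CM condition read on `G₀`**: `c₀ y ∈ S ↔ y ∉ S` (`σ_{c g} = σ̄_g`). [cite: Shimura1998, §18.2 Lemma (i)] -/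
theorem model_mul_mem_iff [Normal ℚ K] (e : (K ≃ₐ[ℚ] K) ≃* G₀) {c₀ : G₀}
    (hc : e ((IsCMField.complexConj K).restrictScalars ℚ) = c₀) (Φ : CMType K) (φ₀ : K →+* ℂ)
    (S : Finset G₀) (hS : ∀ y : G₀, y ∈ S ↔ embOf φ₀ (e.symm y) ∈ Φ.1) (y : G₀) : c₀ * y ∈ S ↔ y ∉ S := by
  have hc' : e.symm c₀ = (IsCMField.complexConj K).restrictScalars ℚ := by rw [← hc, e.symm_apply_apply]
  rw [hS, hS, map_mul, hc']
  exact embOf_complexConj_mul_mem_iff Φ φ₀ _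

omit [Fintype G₀] [DecidableEq G₀] in
/-- **`S` is an abstract CM type for `op c₀`** under the right-translation action of `G₀ᵐᵒᵖ` (`y ∈ S ↔ y c₀ ∉ S`;
`op c₀` commutes with every `op γ` as `c₀` is central; `c₀² = 1`). [cite: Shimura1998, §18.2 Lemma (i)] -/
theorem isCMTypeWith_op [Normal ℚ K] (e : (K ≃ₐ[ℚ] K) ≃* G₀) {c₀ : G₀}
    (hc : e ((IsCMField.complexConj K).restrictScalars ℚ) = c₀) (Φ : CMType K) (φ₀ : K →+* ℂ)
    (S : Finset G₀) (hS : ∀ y : G₀, y ∈ S ↔ embOf φ₀ (e.symm y) ∈ Φ.1) :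
    IsCMTypeWith (op c₀) (↑S : Set G₀) := by
  have hcomm := model_complexConj_comm e hc
  have hcc := model_complexConj_mul_self e hc
  refine ⟨fun y => ?_, fun g y => ?_, fun y => ?_⟩
  · rw [Finset.mem_coe, Finset.mem_coe, op_smul_eq_mul, ← hcomm, model_mul_mem_iff e hc Φ φ₀ S hS, not_not]
  · simp only [MulOpposite.smul_eq_mul_unop, unop_op]
    rw [mul_assoc, mul_assoc, ← hcomm (unop g)]
  · rw [op_smul_eq_mul, op_smul_eq_mul, mul_assoc, hcc, mul_one]

omit [Fintype G₀] [DecidableEq G₀] [IsCMField K] in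
/-- `|G₀| = [K:ℚ]` for a model of the Galois group of a Galois number field. [folklore] -/
theorem card_model_eq_finrank [Fintype G₀] [IsGalois ℚ K] (e : (K ≃ₐ[ℚ] K) ≃* G₀) :
    Fintype.card G₀ = Module.finrank ℚ K := by
  rw [← IsGalois.card_aut_eq_finrank, Nat.card_congr e.toEquiv, Nat.card_eq_fintype_card]

omit [IsCMField K] [DecidableEq G₀] in
/-- **Nondegeneracy on the model**: `Φ` is nondegenerate iff `typeRank G₀ᵐᵒᵖ S = |G₀|/2 + 1`. [cite: Kubota1965, §2 (p. 115)] -/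
theorem isNondegenerate_iff_typeRank_op [IsGalois ℚ K] (e : (K ≃ₐ[ℚ] K) ≃* G₀) (Φ : CMType K) (φ₀ : K →+* ℂ)
    (S : Finset G₀) (hS : ∀ y : G₀, y ∈ S ↔ embOf φ₀ (e.symm y) ∈ Φ.1) :
    IsNondegenerate Φ ↔ typeRank G₀ᵐᵒᵖ (↑S : Set G₀) = Fintype.card G₀ / 2 + 1 := by
  rw [isNondegenerate_iff, cmTypeRank_eq_typeRank_op e Φ φ₀ S hS, card_model_eq_finrank e]

/-! ## §2 Sums over `G₀` along `S ⊔ c₀ S` and along right translates -/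

omit [IsCMField K] in
/-- `Σ_y f(y) [y γ ∈ S] = Σ_{s ∈ S} f(s γ⁻¹)` (the translate indicator of `op γ`). [folklore] -/
theorem sum_mul_translateInd_op (S : Finset G₀) (f : G₀ → ℚ) (γ : G₀) :
    ∑ y, f y * translateInd (↑S : Set G₀) (op γ) y = ∑ s ∈ S, f (s * γ⁻¹) := by
  have h1 : ∀ y, f y * translateInd (↑S : Set G₀) (op γ) y = if y * γ ∈ S then f y else 0 := fun y => by
    by_cases h : y * γ ∈ S
    · rw [translateInd_of_mem (by rwa [op_smul_eq_mul, Finset.mem_coe]), mul_one, if_pos h]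
    · rw [translateInd_of_not_mem (by rwa [op_smul_eq_mul, Finset.mem_coe]), mul_zero, if_neg h]
  calc ∑ y, f y * translateInd (↑S : Set G₀) (op γ) y = ∑ y, (if y * γ ∈ S then f y else 0) :=
        Finset.sum_congr rfl fun y _ => h1 y
    _ = ∑ z, (if z ∈ S then f (z * γ⁻¹) else 0) := by
        refine Fintype.sum_equiv (Equiv.mulRight γ) _ _ fun y => ?_
        simp only [Equiv.coe_mulRight, mul_inv_cancel_right]
    _ = ∑ s ∈ S, f (s * γ⁻¹) := Fintype.sum_ite_mem _ _

omit [IsCMField K] in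
/-- `Σ_y f(y) = Σ_{s∈S} f(s) + Σ_{s∈S} f(c₀ s)` when `S ⊔ c₀ S = G₀`. [folklore] -/
theorem sum_univ_eq_sum_add_sum_mul (S : Finset G₀) {c₀ : G₀} (hScm : ∀ y : G₀, c₀ * y ∈ S ↔ y ∉ S)
    {M : Type*} [AddCommMonoid M] (f : G₀ → M) : ∑ y, f y = ∑ s ∈ S, f s + ∑ s ∈ S, f (c₀ * s) := by
  have hcompl : Sᶜ = S.image (fun s => c₀ * s) := by
    ext y
    simp only [Finset.mem_compl, Finset.mem_image]
    constructor
    · intro hy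
      refine ⟨c₀⁻¹ * y, ?_, by rw [mul_inv_cancel_left]⟩
      by_contra h
      exact hy (by have := (hScm (c₀⁻¹ * y)).2 h; rwa [mul_inv_cancel_left] at this)
    · rintro ⟨s, hs, rfl⟩
      exact fun h => (hScm s).1 h hs
  have hinj : Set.InjOn (fun s => c₀ * s) ↑S := fun a _ b _ h => mul_left_cancel h
  rw [← Finset.sum_add_sum_compl S f, hcompl, Finset.sum_image hinj]

/-! ## §3 The annihilator criterion and the balanced-weight criterion -/

/-- **THE ANNIHILATOR CRITERION.**  `Φ` is nondegenerate iff every `c₀`-antisymmetric rational weight on `G₀`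
annihilated by all right translates of `S` is zero:
`(∀ y, b(c₀ y) = -b(y)) → (∀ g, Σ_{s∈S} b(s g) = 0) → b = 0`.  (Hazama's balanced-weight criterion
`typeRank_eq_iff_forall_nat_symm` on the model, in the coordinates `b = F - F(c₀ ·)`.) [cite: Kubota1965, §2 (p. 115)]
[cite: Gordon1999HodgeAVSurvey, §9.3] -/
theorem isNondegenerate_iff_forall_annihilator [IsGalois ℚ K] (e : (K ≃ₐ[ℚ] K) ≃* G₀) {c₀ : G₀}
    (hc : e ((IsCMField.complexConj K).restrictScalars ℚ) = c₀) (Φ : CMType K) (φ₀ : K →+* ℂ)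
    (S : Finset G₀) (hS : ∀ y : G₀, y ∈ S ↔ embOf φ₀ (e.symm y) ∈ Φ.1) :
    IsNondegenerate Φ ↔ ∀ b : G₀ → ℚ, (∀ y, b (c₀ * y) = -b y) → (∀ g : G₀, ∑ s ∈ S, b (s * g) = 0) → b = 0 := by
  have hcm := isCMTypeWith_op e hc Φ φ₀ S hS
  have hcomm := model_complexConj_comm e hc
  have hcc := model_complexConj_mul_self e hc
  have hScm := model_mul_mem_iff e hc Φ φ₀ S hS
  haveI : Nonempty G₀ := ⟨1⟩
  rw [isNondegenerate_iff_typeRank_op e Φ φ₀ S hS]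
  -- antisymmetric weights have total mass zero
  have hmass : ∀ b : G₀ → ℚ, (∀ y, b (c₀ * y) = -b y) → ∑ y, b y = 0 := fun b hb => by
    have h1 : ∑ y, b y = ∑ y, b (c₀ * y) :=
      (Fintype.sum_equiv (Equiv.mulLeft c₀) (fun y => b (c₀ * y)) b fun y => rfl).symm
    simp only [hb, Finset.sum_neg_distrib] at h1
    linarith
  constructor
  · intro hrank b hb hann
    -- `b` is balanced
    have hbal : IsBalanced G₀ᵐᵒᵖ (↑S : Set G₀) b := by
      intro g
      rw [← op_unop g, sum_mul_translateInd_op, hmass b hb, hann (unop g)⁻¹, mul_zero]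
    funext y
    have hsym := hcm.symm_of_isBalanced_of_typeRank_eq hrank hbal (c₀ * y)
    rw [op_smul_eq_mul, mul_assoc, ← hcomm y, ← mul_assoc, hcc, one_mul, hb] at hsym
    have : b y = 0 := by linarith
    simpa using this
  · intro H
    refine hcm.typeRank_eq_of_forall_nat_symm fun F hF y => ?_
    -- `b = F - F(c₀ ·)` is antisymmetric and annihilated
    set b : G₀ → ℚ := fun y => (F y : ℚ) - F (c₀ * y) with hb_def
    have hb : ∀ y, b (c₀ * y) = -b y := fun y => by
      simp only [hb_def, ← mul_assoc, hcc, one_mul]; ring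
    have hann : ∀ g : G₀, ∑ s ∈ S, b (s * g) = 0 := fun g => by
      have h1 := hF (op g⁻¹)
      rw [sum_mul_translateInd_op, inv_inv] at h1
      have e2 : ∑ y, (F y : ℚ) = ∑ y, (F (y * g) : ℚ) :=
        (Fintype.sum_equiv (Equiv.mulRight g) (fun y => (F (y * g) : ℚ)) (fun y => (F y : ℚ)) fun _ => rfl).symm
      rw [e2, sum_univ_eq_sum_add_sum_mul S hScm (fun y => (F (y * g) : ℚ))] at h1
      simp only [hb_def, Finset.sum_sub_distrib, ← mul_assoc]
      linarith
    have hb0 := H b hb hann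
    have h1 : b y = 0 := by rw [hb0]; rfl
    simp only [hb_def, sub_eq_zero] at h1
    rw [op_smul_eq_mul, ← hcomm]
    exact_mod_cast h1.symm

end Summit.HodgeConjecture.CorCM.GaloisRank

end
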